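import Literature.Probability.RandomPlanarGeometry.SAWIrreducibleBridgeSpanTwoTopClass
import HarnessLib

/-!
# Pulled SAW on `ℤ^{d+1}`: the top axis class of the span-two cell has EXACTLY `C(c−1,3)·(c−2)!·2^{c−2}` members

Topic `Literature/Probability/RandomPlanarGeometry` (sequel of `SAWIrreducibleBridgeSpanTwoTopClass.lean`: rigidity, the insertion map and
the lower bound `2^u·u!·C(u+1,3) ≤ #class`).

THIS FILE (lane «pcv-sawmu», a-p1 g18; all PROVED, standard axioms, NO definitions) proves the matching UPPER bound and hence the COUNT.
With `u = c − 2` and the class `T_u = (irreducibleBridges (u+1) (u+4)).filter (cost u+2 ∧ every lateral axis used)` (= the axis class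
`F_{c,c+2}(c−2)` of `SAWPulledLargeForceExpansionZdCostPolynomial.lean`):
* `exists_skeleton_of_spanTwoTopClass` — ★ the VERTICAL SKELETON: a member has step indices `1 ≤ p`, `p+2 ≤ q`, `q+2 ≤ r ≤ u+3` with height
  `1 + [p<t] − [q<t] + [r<t]` at every time `t ≥ 1` (from the rigidity: one down step `q`, up steps `0, p, r`; the order `p < q < r` by the
  bridge condition, the gaps by self-avoidance);
* `exists_insert_eq_of_spanTwoTopClass` — ★★ SURJECTIVITY of the insertion: the DELETED walk `s ↦ ω(λ s) − g(λ s)·e₀`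
  (`λ s = s + [p ≤ s] + [q ≤ s+1] + [r ≤ s+2]`) lies in the top class of the span-ONE cell (its steps are the lateral steps of `ω`, on fresh
  axes by `lateral_axes_injOn_of_spanTwoTopClass`, whence self-avoidance) and its insertion at `(p, q, r)` is `ω`;
* `card_spanTwoTopClass` — ★★★ `#T_u = 2^u · u! · C(u+1, 3)`, i.e. `F_{c,c+2}(c−2) = C(c−1,3)·(c−2)!·2^{c−2}`.
CONSEQUENCE (lane FINDING-ZD-SYMBOLS.md §2): the span-two cell of the cost census has `[d^{c−2}] N_{c,c+2}(ℤ^{d+1}) = C(c−1,3)·2^{c−2}` — with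
the unit-square class of `SAWCountZdThirdCoefficient.lean` the second input of the THIRD symbol `[d^{k−2}] c_k^{(d)} = (−1)^{k−1}2^{k−2}(k²−5k+7)`
(registered blind as Am. AZ and verified at `k = 10`; its proof is the third-order symbol calculus, not in this file).
[cite: MadrasSlade1993, §4.2, eq. (4.2.20)–(4.2.22) and remark after Theorem 4.2.4 (cost = length − span; down steps); §1.1 eq. (1.1.8) p. 5]
[cite: DuminilCopinHammond2013, §2.2 (irreducible bridges)]

Provenance: lane «pcv-sawmu», a-p1 g18 (2026-08-26); ed.2 (a-p1 g19) = ed.1 verbatim ⊕ one heartbeat budget line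
(`set_option maxHeartbeats 400000 in` on `exists_insert_eq_of_spanTwoTopClass`, LANE NOTICE #11).
-/

noncomputable section

open Finset
open scoped BigOperators
open Literature.Probability.LatticeModels
open Literature.Probability.RandomPlanarGeometry.SAW

namespace Literature.Probability.RandomPlanarGeometry.SAW.Zd

section SpanTwoCount

variable {u : ℕ}

/-- The steps of a self-avoiding walk are unit coordinate vectors `± e_j`. [cite: MadrasSlade1993, §1.1 (p. 1); lane plumbing] -/
private theorem sc_step_dichotomy {D n : ℕ} {ω : ℕ → Site D} (hω : ω ∈ saws D n) {k : ℕ} (hk : k < n) :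
    ∃ j : Fin D, (ω (k + 1) j - ω k j = 1 ∨ ω (k + 1) j - ω k j = -1) ∧ ∀ b, b ≠ j → ω (k + 1) b = ω k b := by
  obtain ⟨j, hj⟩ := (zdGraph_adj_iff_sub _ _).1 ((mem_saws.1 hω).2.2.1 k hk)
  rcases hj with hj | hj
  · refine ⟨j, Or.inl ?_, fun b hb => ?_⟩
    · have h := congrFun hj j; rw [Pi.sub_apply, Pi.single_eq_same] at h; exact h
    · have h := congrFun hj b; rw [Pi.sub_apply, Pi.single_eq_of_ne hb] at h; exact sub_eq_zero.1 h
  · refine ⟨j, Or.inr ?_, fun b hb => ?_⟩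
    · have h := congrFun hj j; rw [Pi.sub_apply, Pi.single_eq_same] at h; omega
    · have h := congrFun hj b; rw [Pi.sub_apply, Pi.single_eq_of_ne hb] at h; omega

/-- Counting indicator along one step. [cite: MadrasSlade1993, §4.2; lane plumbing] -/
private theorem sc_if_lt_succ (a t : ℕ) :
    (if a < t + 1 then (1 : ℤ) else 0) = (if a < t then (1 : ℤ) else 0) + (if a = t then 1 else 0) := by
  split_ifs <;> omega

/-- ★ THE VERTICAL SKELETON of a member of the top axis class of the span-two cell: there are step indices `1 ≤ p`, `p + 2 ≤ q`,
`q + 2 ≤ r ≤ u + 3` such that the height at time `t ≥ 1` is `1 + [p<t] − [q<t] + [r<t]` (up steps exactly at `0, p, r`, the down step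
at `q`). [cite: MadrasSlade1993, §4.2, remark after Theorem 4.2.4; lane lemma] -/
theorem exists_skeleton_of_spanTwoTopClass {ω : ℕ → Site (u + 1)}
    (hT : ω ∈ (irreducibleBridges (u + 1) (u + 4)).filter fun (ω : ℕ → Site (u + 1)) => costZd u (u + 4) ω = u + 2 ∧
        ∀ a : Fin (u + 1), a ≠ 0 → ∃ i ≤ u + 4, ω i a ≠ (0 : ℤ)) :
    ∃ p q r : ℕ, 1 ≤ p ∧ p + 2 ≤ q ∧ q + 2 ≤ r ∧ r ≤ u + 3 ∧
      ∀ t : ℕ, 1 ≤ t → ω t 0 = 1 + ((if p < t then 1 else 0) - (if q < t then 1 else 0) + (if r < t then 1 else 0) : ℤ) := by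
  classical
  obtain ⟨hω, hcost, hall⟩ := Finset.mem_filter.1 hT
  obtain ⟨hb, hn1, hbr, -⟩ := mem_irreducibleBridges.1 hω
  have hsaw : ω ∈ saws (u + 1) (u + 4) := (mem_bridges.1 hb).1
  obtain ⟨h0, hend, hadj, hinj⟩ := mem_saws.1 hsaw
  have h2 := apply_zero_eq_two_of_spanTwoTopClass hω hcost
  have hD := card_down_eq_one_of_spanTwoTopClass hω hcost hall
  have hU := (card_up_eq_three_of_spanTwoTopClass hω hcost hall).1
  -- heights are in [1, 2] after time 0
  have hrange : ∀ t, 1 ≤ t → t ≤ u + 4 → 1 ≤ ω t 0 ∧ ω t 0 ≤ 2 := by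
    intro t ht1 ht2
    have := hbr t ht1 ht2
    rw [h0, h2] at this
    exact ⟨by have := this.1; simp at this; omega, this.2⟩
  -- each step moves the height by −1, 0 or +1
  have hstep : ∀ k, k < u + 4 → ω (k + 1) 0 - ω k 0 = 1 ∨ ω (k + 1) 0 - ω k 0 = 0 ∨ ω (k + 1) 0 - ω k 0 = -1 := by
    intro k hk
    obtain ⟨j, hj, hother⟩ := sc_step_dichotomy hsaw hk
    by_cases hj0 : (0 : Fin (u + 1)) = j
    · subst hj0; rcases hj with h | h
      · exact Or.inl h
      · exact Or.inr (Or.inr h)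
    · exact Or.inr (Or.inl (by rw [hother 0 hj0, sub_self]))
  -- the down step q
  obtain ⟨q, hDq⟩ := Finset.card_eq_one.1 hD
  have hqD : q ∈ (Finset.range (u + 4)).filter fun k => ω (k + 1) 0 < ω k 0 := by rw [hDq]; exact Finset.mem_singleton_self q
  rw [Finset.mem_filter, Finset.mem_range] at hqD
  have hdown_iff : ∀ k, k < u + 4 → (ω (k + 1) 0 < ω k 0 ↔ k = q) := by
    intro k hk
    constructor
    · intro h
      have : k ∈ (Finset.range (u + 4)).filter fun k => ω (k + 1) 0 < ω k 0 :=
        Finset.mem_filter.2 ⟨Finset.mem_range.2 hk, h⟩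
      rw [hDq, Finset.mem_singleton] at this
      exact this
    · rintro rfl; exact hqD.2
  -- the up steps: 0 and two more, p < r
  have h1 : ω 1 0 = 1 := by
    have := hrange 1 le_rfl (by omega)
    rcases hstep 0 (by omega) with h | h | h <;> rw [h0] at h <;> simp at h <;> omega
  have h0U : 0 ∈ (Finset.range (u + 4)).filter fun k => ω k 0 < ω (k + 1) 0 := by
    rw [Finset.mem_filter, Finset.mem_range, h0, h1]; exact ⟨by omega, by simp⟩
  have hU2 : (((Finset.range (u + 4)).filter fun k => ω k 0 < ω (k + 1) 0).erase 0).card = 2 := by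
    rw [Finset.card_erase_of_mem h0U, hU]
  obtain ⟨x, y, hxy, hUe⟩ := Finset.card_eq_two.1 hU2
  obtain ⟨p, r, hpr, hUe'⟩ : ∃ p r : ℕ, p < r ∧
      ((Finset.range (u + 4)).filter fun k => ω k 0 < ω (k + 1) 0).erase 0 = {p, r} := by
    rcases lt_or_gt_of_ne hxy with h | h
    · exact ⟨x, y, h, hUe⟩
    · exact ⟨y, x, h, by rw [hUe, Finset.pair_comm]⟩
  have hup_iff : ∀ k, k < u + 4 → (ω k 0 < ω (k + 1) 0 ↔ k = 0 ∨ k = p ∨ k = r) := by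
    intro k hk
    have key : k ∈ ((Finset.range (u + 4)).filter fun k => ω k 0 < ω (k + 1) 0) ↔ k = 0 ∨ k ∈ (((Finset.range (u + 4)).filter
        fun k => ω k 0 < ω (k + 1) 0).erase 0) := by
      rw [Finset.mem_erase]
      constructor
      · intro h; by_cases hk0 : k = 0; exact Or.inl hk0; exact Or.inr ⟨hk0, h⟩
      · rintro (rfl | ⟨-, h⟩); exact h0U; exact h
    rw [hUe', Finset.mem_insert, Finset.mem_singleton, Finset.mem_filter, Finset.mem_range] at key
    constructor
    · intro h; exact (key.1 ⟨hk, h⟩)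
    · intro h; exact (key.2 h).2
  have hpmem : p ∈ ((Finset.range (u + 4)).filter fun k => ω k 0 < ω (k + 1) 0).erase 0 := by
    rw [hUe']; exact Finset.mem_insert_self _ _
  have hrmem : r ∈ ((Finset.range (u + 4)).filter fun k => ω k 0 < ω (k + 1) 0).erase 0 := by
    rw [hUe']; simp
  rw [Finset.mem_erase, Finset.mem_filter, Finset.mem_range] at hpmem hrmem
  -- p, q, r are pairwise distinct kinds
  have hqp : q ≠ p := fun h => by have := hqD.2; have := hpmem.2.2; rw [h] at *; omega
  have hqr : q ≠ r := fun h => by have := hqD.2; have := hrmem.2.2; rw [h] at *; omega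
  -- the height as a counting function: induction on t
  have hheight : ∀ t, t ≤ u + 4 → ω t 0 = ((if 0 < t then 1 else 0) + (if p < t then 1 else 0) -
      (if q < t then 1 else 0) + (if r < t then 1 else 0) : ℤ) := by
    intro t ht
    induction t with
    | zero => simp [h0]
    | succ t ih =>
      have hk : t < u + 4 := by omega
      have iht := ih (by omega)
      have hd := hdown_iff t hk
      have hu := hup_iff t hk
      simp only [sc_if_lt_succ]
      rcases hstep t hk with h | h | h
      · -- up step: t ∈ {0, p, r}
        have ht : t = 0 ∨ t = p ∨ t = r := hu.1 (by omega)
        have htq : ¬ q = t := fun hh => by have := hd.2 hh.symm; omega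
        rw [show ω (t + 1) 0 = ω t 0 + 1 by omega, iht, if_neg htq]
        rcases ht with ht | ht | ht
        · rw [if_pos ht.symm, if_neg (show ¬ p = t by omega), if_neg (show ¬ r = t by omega)]; ring
        · rw [if_neg (show ¬ 0 = t by omega), if_pos ht.symm, if_neg (show ¬ r = t by omega)]; ring
        · rw [if_neg (show ¬ 0 = t by omega), if_neg (show ¬ p = t by omega), if_pos ht.symm]; ring
      · -- lateral step: t ∉ {0,p,q,r}
        have ht0 : ¬ 0 = t := fun hh => by have := hu.2 (Or.inl hh.symm); omega
        have htp : ¬ p = t := fun hh => by have := hu.2 (Or.inr (Or.inl hh.symm)); omega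
        have htr : ¬ r = t := fun hh => by have := hu.2 (Or.inr (Or.inr hh.symm)); omega
        have ht2 : ¬ q = t := fun hh => by have := hd.2 hh.symm; omega
        rw [show ω (t + 1) 0 = ω t 0 by omega, iht, if_neg ht0, if_neg htp, if_neg htr, if_neg ht2]; ring
      · -- down step: t = q
        have ht : t = q := hd.1 (by omega)
        have ht0 : ¬ 0 = t := fun hh => by have := hu.2 (Or.inl hh.symm); omega
        have htp : ¬ p = t := fun hh => by have := hu.2 (Or.inr (Or.inl hh.symm)); omega
        have htr : ¬ r = t := fun hh => by have := hu.2 (Or.inr (Or.inr hh.symm)); omega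
        rw [show ω (t + 1) 0 = ω t 0 - 1 by omega, iht, if_neg ht0, if_neg htp, if_neg htr, if_pos ht.symm]; ring
  -- order: q after p (else the height drops to 0 at q+1) and before r (else it reaches 3 at r+1)
  have hpq : p < q := by
    by_contra hle
    have hq1 := (hrange (q + 1) (by omega) (by omega)).1
    rw [hheight (q + 1) (by omega)] at hq1
    split_ifs at hq1 <;> omega
  have hqr' : q < r := by
    by_contra hle
    have hr1 := (hrange (r + 1) (by omega) (by omega)).2
    rw [hheight (r + 1) (by omega)] at hr1
    split_ifs at hr1 <;> omega
  -- gaps: an up step immediately followed by the down step (or vice versa) would revisit a site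
  have hvert : ∀ k, k < u + 4 → ω (k + 1) 0 ≠ ω k 0 → ∀ b : Fin (u + 1), b ≠ 0 → ω (k + 1) b = ω k b := by
    intro k hk hne b hb
    obtain ⟨j, hj, hother⟩ := sc_step_dichotomy hsaw hk
    have hj0 : j = 0 := by
      by_contra hj0
      exact hne (hother 0 (fun h => hj0 h.symm))
    subst hj0
    exact hother b hb
  have hgap1 : q ≠ p + 1 := by
    intro hq
    -- ω (p+2) = ω p
    have hup : ω (p + 1) 0 = ω p 0 + 1 := by
      have := (hup_iff p (by omega)).2 (Or.inr (Or.inl rfl))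
      rcases hstep p (by omega) with h | h | h <;> omega
    have hdn : ω (p + 1 + 1) 0 = ω (p + 1) 0 - 1 := by
      have := hqD.2; rw [hq] at this
      rcases hstep (p + 1) (by omega) with h | h | h <;> omega
    have heq : ω (p + 1 + 1) = ω p := by
      funext b
      by_cases hb : b = 0
      · subst hb; omega
      · rw [hvert (p + 1) (by omega) (by omega) b hb, hvert p (by omega) (by omega) b hb]
    have := hinj (show p + 1 + 1 ∈ {i | i ≤ u + 4} by simp; omega) (show p ∈ {i | i ≤ u + 4} by simp; omega) heq
    omega
  have hgap2 : r ≠ q + 1 := by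
    intro hr'
    have hdn : ω (q + 1) 0 = ω q 0 - 1 := by
      have := hqD.2
      rcases hstep q (by omega) with h | h | h <;> omega
    have hup : ω (q + 1 + 1) 0 = ω (q + 1) 0 + 1 := by
      have := (hup_iff r (by omega)).2 (Or.inr (Or.inr rfl))
      rw [hr'] at this
      rcases hstep (q + 1) (by omega) with h | h | h <;> omega
    have heq : ω (q + 1 + 1) = ω q := by
      funext b
      by_cases hb : b = 0
      · subst hb; omega
      · rw [hvert (q + 1) (by omega) (by omega) b hb, hvert q (by omega) (by omega) b hb]
    have := hinj (show q + 1 + 1 ∈ {i | i ≤ u + 4} by simp; omega) (show q ∈ {i | i ≤ u + 4} by simp; omega) heq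
    omega
  refine ⟨p, q, r, by omega, by omega, by omega, by omega, fun t ht => ?_⟩
  by_cases htn : t ≤ u + 4
  · rw [hheight t htn, if_pos (by omega)]; ring
  · rw [hend t (by omega), hheight (u + 4) le_rfl]
    split_ifs <;> omega

/-- Vertical steps of a member of the class (heights `1 + g`) fix every lateral coordinate, and the height jumps exactly at `p, q, r`
(for step indices `≥ 1`). [cite: MadrasSlade1993, §4.2; lane plumbing] -/
private theorem sc_vertical_step {ω : ℕ → Site (u + 1)} (hsaw : ω ∈ saws (u + 1) (u + 4)) {p q r : ℕ}
    (hp : 1 ≤ p) (hpq : p + 2 ≤ q) (hqr : q + 2 ≤ r)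
    (hH : ∀ t : ℕ, 1 ≤ t → ω t 0 = 1 + ((if p < t then 1 else 0) - (if q < t then 1 else 0) + (if r < t then 1 else 0) : ℤ))
    {v : ℕ} (hv : v = p ∨ v = q ∨ v = r) (hvn : v < u + 4) :
    ω (v + 1) = ω v + Pi.single 0 (((if p < v + 1 then 1 else 0) - (if q < v + 1 then 1 else 0) + (if r < v + 1 then 1 else 0) : ℤ) -
      ((if p < v then 1 else 0) - (if q < v then 1 else 0) + (if r < v then 1 else 0) : ℤ)) := by
  have hv1 : 1 ≤ v := by omega
  obtain ⟨j, hj, hother⟩ := sc_step_dichotomy hsaw hvn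
  have hne : ω (v + 1) 0 ≠ ω v 0 := by
    rw [hH (v + 1) (by omega), hH v hv1]
    rcases hv with rfl | rfl | rfl <;> (split_ifs <;> omega)
  have hj0 : j = 0 := by
    by_contra hj0; exact hne (hother 0 (fun h => hj0 h.symm))
  subst hj0
  funext b
  by_cases hb : b = 0
  · subst hb
    rw [Pi.add_apply, Pi.single_eq_same, hH (v + 1) (by omega), hH v hv1]; ring
  · rw [Pi.add_apply, Pi.single_eq_of_ne hb, add_zero, hother b hb]

/-- After a lateral step on a FRESH axis the corresponding coordinate never changes again. [cite: MadrasSlade1993, §4.2; lane plumbing] -/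
private theorem sc_frozen_after_fresh {ω : ℕ → Site (u + 1)}
    (hT : ω ∈ (irreducibleBridges (u + 1) (u + 4)).filter fun (ω : ℕ → Site (u + 1)) => costZd u (u + 4) ω = u + 2 ∧
        ∀ a : Fin (u + 1), a ≠ 0 → ∃ i ≤ u + 4, ω i a ≠ (0 : ℤ))
    {k : ℕ} (hk : k < u + 4) {a : Fin (u + 1)} (ha : a ≠ 0) (hka : ω (k + 1) a ≠ ω k a) :
    ∀ t, k + 1 ≤ t → t ≤ u + 4 → ω t a = ω (k + 1) a := by
  obtain ⟨hω, hcost, hall⟩ := Finset.mem_filter.1 hT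
  intro t hkt htn
  induction t with
  | zero => omega
  | succ t ih =>
    rcases Nat.eq_or_lt_of_le hkt with h | h
    · rw [← h]
    · rw [← ih (by omega) (by omega)]
      by_contra hne
      have := lateral_axes_injOn_of_spanTwoTopClass hω hcost hall (k := t) (l := k) (by omega) hk ha hne hka
      omega

set_option maxHeartbeats 400000 in
/-- ★★ SURJECTIVITY OF THE INSERTION (the DELETE map): every member `ω` of the top axis class of the span-two cell is the insertion,
at its vertical skeleton `(p, q, r)`, of the walk `s ↦ ω(λ s) − g(λ s)·e₀` (`λ s = s + [p ≤ s] + [q ≤ s+1] + [r ≤ s+2]` the largest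
preimage of `s` under the shift), and that walk lies in the top axis class of the span-ONE cell.
[cite: MadrasSlade1993, §4.2, eq. (4.2.20)–(4.2.22); lane lemma] -/
theorem exists_insert_eq_of_spanTwoTopClass {ω : ℕ → Site (u + 1)}
    (hT : ω ∈ (irreducibleBridges (u + 1) (u + 4)).filter fun (ω : ℕ → Site (u + 1)) => costZd u (u + 4) ω = u + 2 ∧
        ∀ a : Fin (u + 1), a ≠ 0 → ∃ i ≤ u + 4, ω i a ≠ (0 : ℤ)) :
    ∃ (ω' : ℕ → Site (u + 1)) (p q r : ℕ),
      ω' ∈ ((irreducibleBridges (u + 1) (u + 1)).filter fun (ω : ℕ → Site (u + 1)) => costZd u (u + 1) ω = u ∧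
        ∀ a : Fin (u + 1), a ≠ 0 → ∃ i ≤ u + 1, ω i a ≠ (0 : ℤ)) ∧
      1 ≤ p ∧ p + 2 ≤ q ∧ q + 2 ≤ r ∧ r ≤ u + 3 ∧
      ∀ t : ℕ, ω t = ω' (t - ((if p < t then 1 else 0) + (if q < t then 1 else 0) + (if r < t then 1 else 0))) +
        Pi.single (0 : Fin (u + 1)) (((if p < t then 1 else 0) - (if q < t then 1 else 0) + (if r < t then 1 else 0) : ℤ)) := by
  classical
  obtain ⟨hω, hcost, hall⟩ := Finset.mem_filter.1 hT
  obtain ⟨hb, hn1, hbr, -⟩ := mem_irreducibleBridges.1 hω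
  have hsaw : ω ∈ saws (u + 1) (u + 4) := (mem_bridges.1 hb).1
  obtain ⟨h0, hend, hadj, hinj⟩ := mem_saws.1 hsaw
  obtain ⟨p, q, r, hp, hpq, hqr, hr, hH⟩ := exists_skeleton_of_spanTwoTopClass hT
  -- the shift, the extra height, the largest preimage
  set m : ℕ → ℕ := fun t => (if p < t then 1 else 0) + (if q < t then 1 else 0) + (if r < t then 1 else 0) with hm
  set g : ℕ → ℤ := fun t => (if p < t then 1 else 0) - (if q < t then 1 else 0) + (if r < t then 1 else 0) with hg
  set lam : ℕ → ℕ := fun s => s + ((if p ≤ s then 1 else 0) + (if q ≤ s + 1 then 1 else 0) + (if r ≤ s + 2 then 1 else 0)) with hlam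
  set ω' : ℕ → Site (u + 1) := fun s => ω (lam s) - Pi.single (0 : Fin (u + 1)) (g (lam s)) with hω'
  -- arithmetic of the preimage
  have hlam_notV : ∀ s, ¬ (lam s = p ∨ lam s = q ∨ lam s = r) := by
    intro s h
    simp only [hlam] at h
    rcases h with h | h | h <;> (split_ifs at h <;> omega)
  have hlam_le : ∀ s, s ≤ u + 1 → lam s ≤ u + 4 := by
    intro s hs; simp only [hlam]; split_ifs <;> omega
  have hlam_lt : ∀ s, s ≤ u → lam s < u + 4 := by
    intro s hs
    have h1 := hlam_le s (by omega)
    have h2 := hlam_notV s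
    simp only [hlam] at h1 h2 ⊢
    split_ifs at h1 h2 ⊢ <;> omega
  have hlam_ge : ∀ s, u + 1 ≤ s → lam s = s + 3 := by
    intro s hs; simp only [hlam]; split_ifs <;> omega
  have hlam_pos : ∀ s, 1 ≤ s → 1 ≤ lam s := fun s hs => by simp only [hlam]; omega
  have hlam0 : lam 0 = 0 := by simp only [hlam]; split_ifs <;> omega
  have hlam_mono : ∀ s s', s < s' → lam s + 1 ≤ lam s' := by
    intro s s' h; simp only [hlam]; split_ifs <;> omega
  -- one step of the preimage: either `+1` or `+2` over a skeleton index
  have hlam_succ : ∀ s, lam (s + 1) = lam s + 1 ∨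
      (lam (s + 1) = lam s + 2 ∧ (lam s + 1 = p ∨ lam s + 1 = q ∨ lam s + 1 = r)) := by
    intro s; simp only [hlam]; split_ifs <;> omega
  -- `g` is constant across a non-skeleton step, and the preimage of a shifted time
  have hg_const : ∀ t, ¬ (t = p ∨ t = q ∨ t = r) → g (t + 1) = g t := by
    intro t ht
    have := (sc_if_lt_succ p t)
    simp only [hg]
    split_ifs <;> omega
  have hlam_shift : ∀ t, (¬ (t = p ∨ t = q ∨ t = r) → lam (t - m t) = t) ∧ ((t = p ∨ t = q ∨ t = r) → lam (t - m t) = t + 1) := by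
    intro t
    constructor
    · intro ht; simp only [hlam, hm]; split_ifs <;> omega
    · intro ht; simp only [hlam, hm]; rcases ht with ht | ht | ht <;> (split_ifs <;> omega)
  -- vertical steps: `ω (v+1) = ω v + (g (v+1) − g v) e₀`
  have hvstep : ∀ v, (v = p ∨ v = q ∨ v = r) → ω (v + 1) = ω v + Pi.single 0 (g (v + 1) - g v) := by
    intro v hv
    exact sc_vertical_step hsaw hp hpq hqr hH hv (by rcases hv with h | h | h <;> omega)
  -- heights of ω'
  have hH' : ∀ s, ω' s 0 = if s = 0 then 0 else 1 := by
    intro s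
    simp only [hω']
    rw [Pi.sub_apply, Pi.single_eq_same]
    by_cases hs : s = 0
    · subst hs; rw [if_pos rfl, hlam0, h0]; simp only [hg, Pi.zero_apply]; split_ifs <;> omega
    · rw [if_neg hs, hH (lam s) (hlam_pos s (by omega))]; simp only [hg]; ring
  -- consecutive differences of ω' are steps of ω
  have hdiff : ∀ s, ω' (s + 1) - ω' s = ω (lam s + 1) - ω (lam s) := by
    intro s
    simp only [hω']
    rcases hlam_succ s with h | ⟨h, hv⟩
    · rw [h, hg_const (lam s) (hlam_notV s)]; abel
    · rw [h, show lam s + 2 = (lam s + 1) + 1 by ring, hvstep (lam s + 1) hv, hg_const (lam s) (hlam_notV s),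
        Pi.single_sub]
      abel
  -- (S1) membership in `saws (u+1) (u+1)`
  have hzero' : ω' 0 = 0 := by
    simp only [hω']; rw [hlam0, h0]; funext b
    by_cases hb : b = 0
    · subst hb; rw [Pi.sub_apply, Pi.single_eq_same]; simp only [hg, Pi.zero_apply]; split_ifs <;> omega
    · rw [Pi.sub_apply, Pi.single_eq_of_ne hb]; simp
  have hfrozen' : ∀ s, u + 1 ≤ s → ω' s = ω' (u + 1) := by
    intro s hs
    simp only [hω']
    rw [hlam_ge s hs, hlam_ge (u + 1) le_rfl, hend (s + 3) (by omega), hend (u + 1 + 3) (by omega)]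
    congr 2
    simp only [hg]; split_ifs <;> omega
  have hadj' : ∀ s < u + 1, (zdGraph (u + 1)).Adj (ω' s) (ω' (s + 1)) := by
    intro s hs
    have h := hadj (lam s) (hlam_lt s (by omega))
    rw [zdGraph_adj_iff_sub] at h ⊢
    obtain ⟨j, hj⟩ := h
    refine ⟨j, ?_⟩
    rcases hj with hj | hj
    · left; rw [hdiff, hj]
    · right; rw [← neg_sub, hdiff, ← neg_sub, hj, neg_neg]
  -- lateral steps of ω at preimage times are on fresh axes ⇒ ω' injective
  have hlateral : ∀ s, 1 ≤ s → s ≤ u → ∃ a : Fin (u + 1), a ≠ 0 ∧ ω (lam s + 1) a ≠ ω (lam s) a := by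
    intro s hs1 hsu
    obtain ⟨j, hj, -⟩ := sc_step_dichotomy hsaw (hlam_lt s hsu)
    refine ⟨j, ?_, by rcases hj with h | h <;> omega⟩
    rintro rfl
    -- a height change at a non-skeleton index ≥ 1 is impossible
    have h1 := hH (lam s + 1) (by have := hlam_pos s hs1; omega)
    have h2 := hH (lam s) (hlam_pos s hs1)
    have h3 := hg_const (lam s) (hlam_notV s)
    simp only [hg] at h3
    rw [h3] at h1
    rcases hj with h | h <;> omega
  have hinj' : Set.InjOn ω' {i | i ≤ u + 1} := by
    intro s hs s' hs' hss
    simp only [Set.mem_setOf_eq] at hs hs'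
    by_contra hne
    have key : ∀ a b : ℕ, a ≤ u + 1 → b ≤ u + 1 → ω' a = ω' b → a < b → False := by
      intro a b ha hb' hab hlt
      by_cases ha0 : a = 0
      · subst ha0
        have := congrFun hab 0
        rw [hH' 0, hH' b, if_pos rfl, if_neg (by omega)] at this
        exact zero_ne_one this
      · obtain ⟨c, hc0, hc⟩ := hlateral a (by omega) (by omega)
        have hfz := sc_frozen_after_fresh hT (hlam_lt a (by omega)) hc0 hc (lam b) (hlam_mono a b hlt) (hlam_le b hb')
        have := congrFun hab c
        simp only [hω', Pi.sub_apply, Pi.single_eq_of_ne hc0, sub_zero] at this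
        rw [hfz] at this
        exact hc this.symm
    rcases lt_or_gt_of_ne hne with hlt | hlt
    · exact key s s' hs hs' hss hlt
    · exact key s' s hs' hs hss.symm hlt
  have hsaw' : ω' ∈ saws (u + 1) (u + 1) := mem_saws.2 ⟨hzero', hfrozen', hadj', hinj'⟩
  -- (S2) bridge, irreducible, cost, axes
  have hB' : IsBridge (u + 1) ω' := by
    intro i hi1 hi2
    rw [hH' 0, hH' i, hH' (u + 1), if_pos rfl, if_neg (by omega), if_neg (by omega)]
    exact ⟨zero_lt_one, le_rfl⟩
  have hirr' : IsIrreducibleBridge (u + 1) ω' := by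
    refine ⟨by omega, hB', fun k hk1 hk2 hren => ?_⟩
    have h := (hren.2.2 1 le_rfl (by omega)).1
    simp only [add_zero] at h
    rw [hH' k, hH' (k + 1), if_neg (by omega), if_neg (by omega)] at h
    exact lt_irrefl _ h
  have hmem' : ω' ∈ (irreducibleBridges (u + 1) (u + 1)).filter fun (ω : ℕ → Site (u + 1)) => costZd u (u + 1) ω = u ∧
      ∀ a : Fin (u + 1), a ≠ 0 → ∃ i ≤ u + 1, ω i a ≠ (0 : ℤ) := by
    refine Finset.mem_filter.2 ⟨mem_irreducibleBridges.2 ⟨mem_bridges.2 ⟨hsaw', hB'⟩, hirr'⟩, ?_, ?_⟩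
    · rw [costZd, hH' (u + 1), if_neg (by omega)]; simp
    · intro a ha
      obtain ⟨i, hi, hne⟩ := hall a ha
      refine ⟨i - m i, ?_, ?_⟩
      · show i - m i ≤ u + 1
        simp only [hm]; split_ifs <;> omega
      · simp only [hω', Pi.sub_apply, Pi.single_eq_of_ne ha, sub_zero]
        by_cases hiV : i = p ∨ i = q ∨ i = r
        · rw [(hlam_shift i).2 hiV, hvstep i hiV, Pi.add_apply, Pi.single_eq_of_ne ha, add_zero]
          exact hne
        · rw [(hlam_shift i).1 hiV]
          exact hne
  refine ⟨ω', p, q, r, hmem', hp, hpq, hqr, hr, fun t => ?_⟩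
  -- the insertion of ω' at (p, q, r) is ω
  show ω t = ω' (t - m t) + Pi.single 0 (g t)
  simp only [hω']
  by_cases htV : t = p ∨ t = q ∨ t = r
  · rw [(hlam_shift t).2 htV, hvstep t htV]
    rw [add_sub_assoc, ← Pi.single_sub, add_assoc, ← Pi.single_add]
    simp
  · rw [(hlam_shift t).1 htV, sub_add_cancel]

/-- ★★★ THE COUNT OF THE TOP AXIS CLASS OF THE SPAN-TWO CELL: `F_{c,c+2}(c−2) = C(c−1,3)·(c−2)!·2^{c−2}` (with `u = c − 2`:
`#class = 2^u · u! · C(u+1, 3)`). Lower bound: the insertion of `SAWIrreducibleBridgeSpanTwoTopClass.lean`; upper bound: every member is an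
insertion (`exists_insert_eq_of_spanTwoTopClass`). This is the span-two input of the THIRD symbol of the cost census
(`[d^{c−2}] N_{c,c+2}(ℤ^{d+1}) = C(c−1,3)·2^{c−2}`, lane FINDING-ZD-SYMBOLS.md §2).
[cite: MadrasSlade1993, §4.2, eq. (4.2.20)–(4.2.22) and remark after Theorem 4.2.4; §1.1 eq. (1.1.8) p. 5; lane theorem] -/
theorem card_spanTwoTopClass (u : ℕ) :
    ((irreducibleBridges (u + 1) (u + 4)).filter fun (ω : ℕ → Site (u + 1)) => costZd u (u + 4) ω = u + 2 ∧
        ∀ a : Fin (u + 1), a ≠ 0 → ∃ i ≤ u + 4, ω i a ≠ (0 : ℤ)).card = 2 ^ u * u.factorial * (u + 1).choose 3 := by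
  classical
  refine le_antisymm ?_ (choose_mul_le_card_spanTwoTopClass u)
  set S := (irreducibleBridges (u + 1) (u + 1)).filter fun (ω : ℕ → Site (u + 1)) => costZd u (u + 1) ω = u ∧
    ∀ a : Fin (u + 1), a ≠ 0 → ∃ i ≤ u + 1, ω i a ≠ (0 : ℤ) with hS
  set TR := (((Finset.range (u + 4)) ×ˢ ((Finset.range (u + 4)) ×ˢ (Finset.range (u + 4)))).filter
    fun (x : ℕ × ℕ × ℕ) => 1 ≤ x.1 ∧ x.1 + 2 ≤ x.2.1 ∧ x.2.1 + 2 ≤ x.2.2 ∧ x.2.2 ≤ u + 3) with hTR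
  have hScard : S.card = 2 ^ u * u.factorial := card_topAxesClass_self u
  have hTRcard : TR.card = (u + 1).choose 3 := card_admissibleTriples u
  rw [← hScard, ← hTRcard, ← Finset.card_product]
  refine le_trans (Finset.card_le_card (t := (S ×ˢ TR).image fun (x : (ℕ → Site (u + 1)) × ℕ × ℕ × ℕ) => fun t : ℕ =>
      x.1 (t - ((if x.2.1 < t then 1 else 0) + (if x.2.2.1 < t then 1 else 0) + (if x.2.2.2 < t then 1 else 0))) +
        Pi.single (0 : Fin (u + 1)) (((if x.2.1 < t then 1 else 0) - (if x.2.2.1 < t then 1 else 0) +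
          (if x.2.2.2 < t then 1 else 0) : ℤ))) ?_) Finset.card_image_le
  intro ω hωT
  obtain ⟨ω', p, q, r, hmem', hp, hpq, hqr, hr, hins⟩ := exists_insert_eq_of_spanTwoTopClass hωT
  rw [Finset.mem_image]
  refine ⟨(ω', (p, q, r)), ?_, ?_⟩
  · rw [Finset.mem_product]
    refine ⟨hmem', ?_⟩
    rw [hTR, Finset.mem_filter, Finset.mem_product, Finset.mem_product, Finset.mem_range, Finset.mem_range, Finset.mem_range]
    exact ⟨⟨show p < u + 4 by omega, show q < u + 4 by omega, show r < u + 4 by omega⟩, hp, hpq, hqr, hr⟩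
  · funext t
    exact (hins t).symm

end SpanTwoCount

end Literature.Probability.RandomPlanarGeometry.SAW.Zd
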